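import Mathlib
import HarnessLib
import HarnessLib.Audit
import Summits.Langlands.Statement
import Literature.NumberTheory.GaloisRepresentations.OrdinaryGaloisRep
import Literature.NumberTheory.GaloisRepresentations.EvenGaloisRep
import Literature.NumberTheory.Automorphic.GLnAdelicStructureProofs
import Literature.NumberTheory.GaloisRepresentations.PadicComplexEmbedding
import HarnessLib.Audit.Status.Attr

/-!
Route: EvenSkinnerWilesMirror

# Route EvenSkinnerWilesMirror — no even residually-reducible ordinary ρ over ℚ — Skinner–Wiles at
defect one run through the parity-blind Bianchi mirror

It suffices to show X = NoEvenReducibleOrdinary: for every odd prime p there is NO continuous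
irreducible EVEN ρ : Γ_ℚ → GL₂(ℚ̄_p),
unramified almost everywhere, admitting a residually upper-triangular integral model ρ₀ over the
valuation ring O of ℚ̄_p
(ρ̄^ss = χ̄_a ⊕ χ̄_b) which at p is p-distinguished and ordinary of one EVEN weight k ≥ 2 with
Skinner–Wiles orientation (the local
clause of route SkinnerWilesDefectOne's target, verbatim, with F := ℚ) — typed with one auxiliary
binder (an imaginary quadratic K in
which p splits; ℚ(√(1−4p)) is one) that the conclusion False does not mention (ι : ℚ̄_p ≃ ℂ is
obtained inside the glue from the tree's
nonempty_algebraicClosure_padic_ringEquiv_complex). X is a sector of conjunct (B) for n = 2 over ℚ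
which (B)
predicts to be EMPTY (Fontaine–Mazur + oddness of modular ρ); it is the even half that
Calegari2011/Calegari2012 cannot reach
(they need ρ̄ absolutely irreducible, non-dihedral) and where MirrorPairReflection's census stops at
genuine mirror pairs. RECOMBINATION
(lens recomb): the door of ParityBlindBianchi (parity disappears over K), the engine of
SkinnerWilesDefectOne (imported as the shared
item ReducibleOrdinaryModular = stmt-Langlands-12918), the sector of MirrorPairReflection, the
vacuity assembly of SelfDefeatingInduction.
Lean: `∀ (p : ℕ) [Fact p.Prime], p ≠ 2 → ∀ (K : Type) [Field K] [NumberField K],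
NumberField.IsTotallyComplex K → Module.finrank ℚ K = 2 → (∀ w : IsDedekindDomain.HeightOneSpectrum
(NumberField.RingOfIntegers K), (p : NumberField.RingOfIntegers K) ∈ w.asIdeal → w.residueCard = p ∧
¬ w.asIdeal ^ 2 ∣ Ideal.span {(p : NumberField.RingOfIntegers K)}) → ∀ (O : ValuationSubring
(PadicAlgCl p)), O = (Valued.v : Valuation (PadicAlgCl p) NNReal).valuationSubring → ∀ (ρ :
Literature.NumberTheory.GaloisRepresentations.FramedGaloisRep ℚ (PadicAlgCl p) 2) (ρ₀ :
Field.absoluteGaloisGroup ℚ →* Matrix.GeneralLinearGroup (Fin 2) O), ρ.toGaloisRep.IsIrreducible →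
ρ.IsEven → (∀ᶠ v in cofinite, ρ.IsUnramifiedAt v) → ρ.HasUpperTriangularIntegralModel ρ₀ → (∃ k : ℕ,
2 ≤ k ∧ Even k ∧ ∃ m : ℕ, 0 < m ∧ ∀ v : IsDedekindDomain.HeightOneSpectrum
(NumberField.RingOfIntegers ℚ), (p : NumberField.RingOfIntegers ℚ) ∈ v.asIdeal →
Literature.NumberTheory.GaloisRepresentations.IsPDistinguishedAt ρ₀ v ∧ ∃ Q :
Matrix.GeneralLinearGroup (Fin 2) (PadicAlgCl p), Valued.v (Q.val 0 0) ≤ Valued.v (Q.val 1 0) ∧ ∀ σ,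
(Q⁻¹ * ρ.toLocal v σ * Q).val 1 0 = 0 ∧ (σ ∈
Literature.NumberTheory.GaloisRepresentations.absInertia (v.adicCompletion ℚ) → (Q⁻¹ * ρ.toLocal v σ
* Q).val 1 1 ^ m = 1 ∧ (Q⁻¹ * ρ.toLocal v σ * Q).val 0 0 ^ m = algebraMap (Padic p) (PadicAlgCl p)
(((Literature.NumberTheory.GaloisRepresentations.GaloisRep.cyclotomicCharacter (v.adicCompletion ℚ)
p σ).val : PadicInt p) : Padic p) ^ ((k - 1) * m))) → False`

## Assembly
Pure logic, certified by the deciding theorem in glue.lean (rc 0 in Sketch.lean): `closes :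
BianchiMirrorParity → MirrorEntry →
ReducibleOrdinaryModular → DeterminantParity → SectorComplement → Langlands` := SectorComplement
applied to the target, which is derived
inline: fix p, K (p split), O, ρ, ρ₀ and the hypotheses, obtain ι : ℚ̄_p ≃+* ℂ
(nonempty_algebraicClosure_padic_ringEquiv_complex); MirrorEntry gives ρ₀' and the SW bundle for
ρ.restrictField K;
ReducibleOrdinaryModular (with the PROVED compactness witness isCompact_glFiniteIntegralLevel_holds
2 K) gives π; DeterminantParity turns
the oriented clause into det(ρ)^N = ε^{(k−1)N}; BianchiMirrorParity gives ρ.IsOdd;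
FramedGaloisRep.IsEven.not_isOdd (Rat.castHom ℝ,
two_ne_zero) closes with False.

Rationale: WHY THIS LINE. Mechanism: an even ρ restricted to an imaginary quadratic K keeps every Skinner–Wiles
hypothesis (irreducibility of ρ|_K is automatic
for even ρ; p split in K keeps p-distinguishedness and the oriented ordinary frame, the Iwahori
conjugation preserving ‖Q₀₀‖ ≤ ‖Q₁₀‖ —
crux MirrorEntry), and residual REDUCIBILITY is exactly the residual type whose residual automorphy
over K is free (Eisenstein), so the
defect-one engine of route SkinnerWilesDefectOne (SkinnerWiles1999 transposed to K;
CalegariGeraghty2017, arXiv:2301.10509) applies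
with no oddness input and yields a weakly compatible cuspidal π on GL₂(𝔸_K); π ≅ π^c by strong
multiplicity one, so π descends to ℚ
(ArthurClozelAMS120 Ch. 3 Thm 4.2(d) / Langlands 1980), and the ODD Tate-twist exponent k−1 of det ρ
(k even; crux DeterminantParity)
forces the descended π₀ to have distinct archimedean exponents a ≠ b (a + b ≡ k − 1), i.e. to be
regular algebraic after |det|^{1/2} —
the algebraic-Maass / weight-one branch, whose Galois avatars would be even, is excluded at the
level of infinity types — whence
ρ ≅ ρ_{π₀} ⊗ ε_K^j is odd (Deligne; crux BianchiMirrorParity): contradiction. Imported areas: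
positive-defect automorphy lifting
(through the shared crux only), cyclic base change (Arthur–Clozel), archimedean representation
theory of GL₂(ℝ) (unitarity of
integral-parameter principal series), class field theory of ℚ (Kronecker–Weber/Minkowski for
DeterminantParity). What no parent had:
ParityBlindBianchi owns the door but meets the Artin-weight classicality wall and has no residual
modularity over K for A₅ images;
SkinnerWilesDefectOne owns the engine but harvests only statements over K; MirrorPairReflection owns
the sector but has no engine at
genuine mirror pairs or away from conductor p ("SW/Pan need oddness", its header): together they
give a theorem over ℚ in regular weight.

RANKED CRUXES. #0 NoEvenReducibleOrdinary (target) — X as in § Thesis: p odd; K imaginary quadratic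
with every w ∣ p of residue degree one and unramified (auxiliary); O pinned; ρ : Γ_ℚ → GL₂(ℚ̄_p)
irreducible, EVEN, a.e. unramified, with residually upper-triangular integral model ρ₀, and an even
k ≥ 2, m ≥ 1 such that at the place above p: IsPDistinguishedAt ρ₀ v and an oriented ordinary frame
Q (‖Q₀₀‖ ≤ ‖Q₁₀‖, lower-left of Q⁻¹ρ|D_vQ zero, on inertia θ₂^m = 1 and θ₁^m = ε^{(k−1)m}) ⟹ False.
(why it might fail: False only if Fontaine–Mazur fails for an even ordinary regular ρ over ℚ;
unreachable-though-true for odd k (algebraic-Maass loophole) — hence k even; vacuity-by-typing is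
excluded because the clauses are SW's audited ones with F := ℚ.) [Calegari2011, arXiv:1012.4819,
SkinnerWiles1999, FontaineMazurGeometric1995, arXiv:1611.09315]
#2 BianchiMirrorParity (crux) — THE LEVER. p prime, K imaginary quadratic, ι : ℚ̄_p ≃ ℂ, ρ : Γ_ℚ →
GL₂(ℚ̄_p) a.e. unramified with ρ|_{Γ_K} irreducible and det(ρ)^N = ε^{(k−1)N} for some N ≥ 1 and
some EVEN k ≥ 2 (det ρ is a finite-order twist of an ODD power of the cyclotomic character); if
ρ|_{Γ_K} is weakly Bianchi-modular — some L-algebraic cuspidal π on GL₂(𝔸_K) has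
SatakeFrobCompatibleAt ι π (ρ|_K) w for cofinitely many w — then ρ is ODD. Proof line: ρ|_K ≅
(ρ|_K)^c ⇒ π ≅ π^c (SMO) ⇒ π = BC(π₀) (Arthur–Clozel 4.2(d), with the archimedean clause) ⇒ ω_{π₀} =
ψ‖·‖^{±(k−1)} (Satake–Frobenius at split primes + rigidity of idele class characters of ℚ) ⇒
infinity type {(a,b),(b,a)} of π₀ has a + b = ±(k−1) odd ⇒ a ≠ b ⇒ π₀ ⊗ |det|^{1/2} regular
algebraic ⇒ ρ_{π₀} odd (Deligne) and ρ ≅ ρ_{π₀} ⊗ ε_K^j (Chebotarev + Brauer–Nesbitt over K,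
Clifford) ⇒ odd. [difficulty: L] (why it might fail: FALSE without 'Even k' (Ind from a real
quadratic field: even dihedral Maass λ=1/4, k=1); as typed the risk is normalisation (direction of
the Satake–Frobenius ↔ central-character dictionary must give a+b ≡ k−1) and the archimedean clause
of cyclic descent needed to read π₀'s infinity type.) [ArthurClozelAMS120, LanglandsBaseChange1980,
Calegari2011, BuzzardGeeLMS2014, Deligne1971]
#3 MirrorEntry (crux) — ENTERING THE MIRROR. Given the ℚ-side data of the target (p odd, O pinned, ρ
irreducible, even, a.e. unramified, upper-triangular model ρ₀, even k ≥ 2, m, and at the place over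
p: p-distinguished + oriented ordinary frame) and any imaginary quadratic K in which p splits (every
w ∣ p of residue degree one, unramified), the restriction ρ|_{Γ_K} with ρ₀' := ρ₀ ∘ res satisfies
EVERY hypothesis of ReducibleOrdinaryModular over K: irreducible (an even irreducible ρ is never
induced from an imaginary quadratic field: Ind swaps the two lines, det ρ(c) = −1), a.e. unramified,
residually upper-triangular, and at each w ∣ p p-distinguished with an oriented ordinary frame (the
local groups at w and at p are identified up to Γ_ℚ-conjugacy; conjugating by ρ(τ) ∈ GL₂(O),
upper-triangular mod 𝔪, preserves ‖Q₀₀‖ ≤ ‖Q₁₀‖ ultrametrically). [difficulty: M] (why it might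
fail: (ρ.restrictField K).toLocal w equals ρ.toLocal v only up to Γ_ℚ-conjugacy
(absGaloisRestrict_isConj_of_algHom is a named fact); for inert p distinguishedness can die
(χ̄_aχ̄_b⁻¹|D_p unramified quadratic) — hence p split; orientation transfer needs the conjugator
integral and residually Borel.) [SkinnerWiles1999, MilneFT2022, Ribet1976, BellaicheChenevier2009]
#4 ReducibleOrdinaryModular (crux) — IMPORTED ENGINE — verbatim the target X of route
SkinnerWilesDefectOne (stmt-Langlands-12918; provenance: from route-Langlands-SkinnerWilesDefectOne,
its whole mechanism: pro-modularity at defect one with the auxiliary Steinberg pin + ordinary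
classicality; staffed THERE, re-asked here so that this route's uncertainty is exactly its crux
list): over an imaginary quadratic F, p ≠ 2, every irreducible a.e.-unramified ρ : Γ_F → GL₂(ℚ̄_p)
with residually upper-triangular integral model, p-distinguished and SW-oriented ordinary of one
parallel weight k ≥ 2 at every v ∣ p, is weakly modular: an L-algebraic cuspidal π on GL₂(𝔸_F) with
Satake–Frobenius matching at cofinitely many v. [difficulty: open-problem] (why it might fail: =
Fontaine–Mazur (B) in SW's sector over imaginary quadratic F (defect one): reducible locus of
dimension ≤ 3 only in the regime r₀ ≤ 2, auxiliary Steinberg re-entry and ordinary classicality over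
F unproved (judge key_risk of the parent route).) [SkinnerWiles1999, CalegariGeraghty2017,
arXiv:2301.10509, BergerKlosin2009, AllenNewtonThorne2020]
#8 DeterminantParity (crux) — BOOKKEEPING (provable now, class field theory of ℚ): p odd, ρ : Γ_ℚ →
GL₂(ℚ̄_p) a.e. unramified, k ≥ 2, m ≥ 1, and at the place over p an (un-oriented) ordinary frame
with θ₂^m = 1, θ₁^m = ε^{(k−1)m} on inertia ⟹ ∃ N ≥ 1 with det(ρ(g))^N = ε(g)^{(k−1)N} for all g ∈
Γ_ℚ. Proof: χ := det ρ · ε^{1−k} has χ^m trivial on I_p, finite order on every other inertia group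
(ℓ-adic inertia into a p-adic field), so a power of χ is unramified at all finite places, hence
trivial (ℚ has no abelian extension unramified at all finite primes: Kronecker–Weber / Minkowski,
Mathlib NumberField.abs_discr_gt_two on finite quotients of the profinite image). [difficulty:
provable-now] (why it might fail: only by a mismatch between the local cyclotomic character at
v.adicCompletion ℚ and the global one on Γ_ℚ under toLocal (a tree-API compatibility not yet
stated), or if the image of det ρ were not profinite — both are bookkeeping, not mathematics.)
[NeukirchANT1999, CasselsFrohlichANT1967, SkinnerWiles1999]
#9 SectorComplement (crux) — THE DECLARED RESIDUAL: the summit outside this (empty) sector — X →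
Langlands. Summit-strength modulo X by design (every other (F, n, ρ, π), direction (A), and within n
= 2 over ℚ the odd, the residually irreducible even (Calegari), the non-ordinary and the odd-k even
cases); ranked last, not where this route directs provers, a crux so that the hypotheses of closes
are exactly the crux list (D-0027 §2.2). [deps: NoEvenReducibleOrdinary] [difficulty: open-problem]
(why it might fail: it IS global reciprocity for GL_n minus one vacuous sector; no engine is
claimed; it closes only with the summit.) [BuzzardGeeLMS2014, FontaineMazurGeometric1995,
Calegari2011]

TWO-LAYER PLAN. Foreseen only: BianchiMirrorParity ⇐ DescentToQ (π ≅ π^c ⇒ π = BC(π₀), archimedean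
clause included) → CentralCharacterParity (a + b =
±(k−1) from Satake–Frobenius at split primes) → OddFromRegularDescent (Deligne +
Chebotarev/Brauer–Nesbitt over K + Clifford); MirrorEntry ⇐
LocalTransferAtSplitPrime → RestrictionIrreducibleOfEven. Filed as glued splits only on a prover's
demand.

KILL CRITERIA. (a) BianchiMirrorParity refuted AS TYPED by a normalisation witness (direction of the
Satake–Frobenius dictionary making a+b ≡ k rather
than k−1) ⇒ refuted-misstated: re-file with the parity flipped to the correct exponent and
re-certify closes; refuted MATHEMATICALLY (an
even ρ with odd Tate-twist exponent whose restriction to some K is weakly Bianchi-modular) would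
contradict Arthur–Clozel descent + Deligne
and is not expected — close refuted:BianchiMirrorParity. (b) ReducibleOrdinaryModular refuted or
SkinnerWilesDefectOne closed refuted at
its target ⇒ this route closes with it (superseded/refuted:ReducibleOrdinaryModular);
SkinnerWilesDefectOne closed EXHAUSTED does not kill
the statement, only its staffing. (c) MirrorEntry refuted as typed (toLocal identification) ⇒
misstated, repair by inserting the
conjugating element; mathematically it is Clifford + ultrametric bookkeeping. (d) A printed theorem
excluding even residually-reducible
geometric ρ of regular weight (a sequel of arXiv:1012.4819 or of Pan2022 without oddness) makes the
sector known: superseded for staffing.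

NOT DECOMPOSED YET. The orientation-free corollary (Ribet's two-lattice lemma supplies an
SW-oriented lattice for EVERY irreducible residually-reducible
p-distinguished ordinary ρ: choose the endpoint lattice whose global sub is the character NOT
carried by the ordinary line; BellaicheChenevier2009
§1.5) — a support item once a prover wants the clean headline; the odd-k half of the sector (needs
(A) for algebraic Maass forms of
eigenvalue 1/4, i.e. the even-Artin wall — deliberately left in SectorComplement); the auxiliary
field ℚ(√(1−4p))-type existence lemma
(K-free form of X); the printed inputs of BianchiMirrorParity (Arthur–Clozel cyclic descent with its
archimedean clause in the RepData
model — tree: cuspidal_descent_cyclic / ArthurClozel1989_cuspidal_descent; Deligne's ρ_{π₀} with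
oddness; strong multiplicity one) enter
as Literature named facts claimed by the first prover (D-0027 §3.3) or, on a tenure pass, as (h :
Fact) → re-filings; nothing non-ordinary
or residually irreducible (Calegari's theorems) is touched.

CHEAPEST FALSIFIER. MUTATION of the lever, runnable on paper today: drop 'Even k' in
BianchiMirrorParity — ρ = Ind_{ℚ(√5)}^{ℚ} χ (χ a ray-class character of
order ≥ 3), an even dihedral Artin representation, is weakly Bianchi-modular over every imaginary
quadratic K ≠ ℚ(√5)·(anything) through
the base change of its Maass form of eigenvalue 1/4, has det of finite order (k = 1) and is NOT odd:
the item must survive exactly because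
k − 1 is odd. LOOKUP (done 2026-08-16): zbMATH 'even Galois representations reducible' (12 rows:
SkinnerWiles1999, FKP 2022, Calegari II,
Berger–? none on the even reducible regular case), arXiv 'even Galois representations
Fontaine-Mazur' (4 rows: Calegari I/II,
Berger arXiv:1611.09315 — Prop. 2: conductor p + Vandiver only), Calegari II p. 3 read: 'ρ̄
absolutely irreducible and not of dihedral type'.

NUMBERS. Calegari2011 Thm 1.2 / Cor 1.3: p > 7, ordinary distinct weights, SL₂(𝔽_p) ⊂ im ρ̄;
arXiv:1012.4819 Thm 1.1–1.2: p > 7 (resp. p ≠ 7?),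
ρ̄ absolutely irreducible non-dihedral, Sym² ρ̄|_{G_{F(ζ_p)}} irreducible; Berger arXiv:1611.09315
Prop. 2: ρ̄^ss = 1 ⊕ ε̄^m, conductor p,
ordinary or FL-crystalline, Vandiver ⇒ odd; MirrorPairReflection: conductor p^∞, void below 8192 /
AAC primes > 2·10^11. This route: any
conductor, any odd p, k even ≥ 2, conditional on nothing but its cruxes. Items at open: 7 (target +
5 cruxes + assembly).

DEFINITION REQUESTS. None: FramedGaloisRep.IsEven / IsOdd / restrictField,
HasUpperTriangularIntegralModel, IsPDistinguishedAt, absInertia,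
GaloisRep.cyclotomicCharacter, CuspidalAutomorphicRepData, SatakeFrobCompatibleAt all exist (lean
search --decl; Sketch.lean rc 0).

Novelty: Searches (2026-08-16): zbMATH 'even Galois representations Fontaine-Mazur conjecture Calegari' (1),
'even Galois representations reducible'
(12), 'even Galois representation imaginary quadratic modularity' (2: AKT 2023, BSV); arXiv 'even
Galois representations Fontaine-Mazur'
(4: arXiv:0907.3427, arXiv:1012.4819, arXiv:1611.09315, arXiv:2005.12799); lit galaxy search 'even
Galois representations' --star all (2,
irrelevant), 'residually reducible' --star pdf (4: Wake–Wang-Erickson, Bellaïche–Pollack, JNWE);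
reads: arXiv:0907.3427 pp. 1–2,
arXiv:1012.4819 pp. 2–3, arXiv:1611.09315 pp. 1–3, arXiv:2110.10251 pp. 10–11, 120–121 (to kill an
earlier candidate); the hub's 130 idea
cards grepped for even+reducible+Bianchi (hits: parity-does-irreducibility names 'σ̄ reducible even'
as OPEN, no engine; MirrorPairReflection
header: 'SkinnerWiles1999 / Pan2022 need oddness'); local searchd / OpenAlex / S2 unavailable (rc
reset / 429) this session.
Nearest prior art found: Calegari2011 = arXiv:0907.3427 and arXiv:1012.4819 (even FM for residually
big image, via potential automorphy
of Sym²/over totally real fields); Berger arXiv:1611.09315 Prop. 2 (residually reducible, conductor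
p, conditional on Vandiver, by Ribet's
lattice + Herbrand); route MirrorPairReflection (conductor p^∞ census); route ParityBlindBianchi /
card parity-blind-prime-two-even-artin
(the imaginary-quadratic door for even ICOSAHEDRAL Artin ρ at p = 2); route SkinnerWilesDefectOne
(the engine, over K only).
Delta: run th  [refs: 0907.3427, 1012.4819, 1611.09315, 2005.12799, 2110.10251, SkinnerWiles1999, Pan2022, Calegari2011]

Barriers (technique_class: automorphy-lifting, cyclic-base-change, parity): - technique_class: automorphy-lifting, cyclic-base-change, parity
- Literature.Barriers.Langlands.TaylorWilesNumericalCoincidence: the CHT coincidence is 'an oddness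
condition' (the barrier file's own quotation): for even ρ over ℚ it fails by exactly l₀ = 1, the
same defect as GL₂ over an imaginary quadratic field — the line does not fight it over ℚ but moves
to K, where the positive-defect engine is the imported crux ReducibleOrdinaryModular
(Calegari–Geraghty complexes, SW nice primes); honest residue: the barrier is met inside that crux,
by the parent route.
- Literature.Barriers.Langlands.TaylorWilesNumericalCoincidenceNarrow: same; no self-duality is used
or needed (ρ|_K is not assumed polarized).
- Literature.Barriers.Langlands.ResiduallyReducibleBarrier: met head-on and turned into the resource
— residual reducibility is what makes residual automorphy over K free (Eisenstein classes) where
Serre's conjecture over K is unavailable for even ρ̄; the lifting itself is SW's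
pseudo-deformation/nice-prime method (inside the imported crux), not Taylor–Wiles–Kisin with big
image.
- Literature.Barriers.Langlands.ResiduallyReducibleBarrierNarrow: same as the wide entry — residual
reducibility is a standing hypothesis and the resource (free residual automorphy over K); no
Taylor–Wiles–Kisin big-image patching is run by this route's own cruxes.
- Literature.Barriers.Langlands.PatchingLocalComponentBarrierNarrow: not engaged by this route's own
cruxes; met inside the imported crux e

History (route lifecycle, newest last):
- 2026-08-24T01:23:12Z · DORMANT — reconciler: no traction for 6.4 d (last activity item-evidence-added at 2026-08-17T14:55:46Z); parked, not closed — `ledger route dormant route-Langlands-EvenSk (operator:999:1465056)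
- 2026-08-29T00:26:47Z · REACTIVATED — reconciler: reactivated — activity statement-checked at 2026-08-28T21:32:23Z after parking at 2026-08-24T01:23:12Z (operator:999:4053449)

sub-problem: Langlands · status: open · opened planner-plan-lens-Langlands-recomb-0 2026-08-16T15:21:48Z · rev 3 · ledger route-Langlands-EvenSkinnerWilesMirror
GENERATED by the gate from the ledger (D-0016/17). Provers cite these decls: `theorem foo : Summit.Langlands.Langlands.Theses.EvenSkinnerWilesMirror.<Decl> := …` in Summits/Langlands/Langlands/Theorems/<Name>.lean.
-/

namespace Summit.Langlands.Langlands.Theses.EvenSkinnerWilesMirror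

open scoped BigOperators Topology Manifold Classical MeasureTheory ProbabilityTheory Matrix InnerProductSpace ComplexConjugate ContinuousMap
open Filter Set Function TopologicalSpace MeasureTheory

attribute [summit_statement] _root_.Langlands

/-- item stmt-Langlands-15308 · target · rank 0 · open · by planner
why it might fail: False only if Fontaine–Mazur fails for an even ordinary regular ρ over ℚ; unreachable-though-true for odd k (algebraic-Maass loophole) — hence k even; vacuity-by-typing is excluded because the clauses are SW's audited ones with F := ℚ.
sources: Calegari2011, arXiv:1012.4819, SkinnerWiles1999, FontaineMazurGeometric1995, arXiv:1611.09315
[target] X as in § Thesis: p odd; K imaginary quadratic with every w ∣ p of residue degree one and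
unramified (auxiliary); O pinned; ρ : Γ_ℚ → GL₂(ℚ̄_p) irreducible, EVEN, a.e. unramified, with
residually upper-triangular integral model ρ₀, and an even k ≥ 2, m ≥ 1 such that at the place above
p: IsPDistinguishedAt ρ₀ v and an oriented ordinary frame Q (‖Q₀₀‖ ≤ ‖Q₁₀‖, lower-left of Q⁻¹ρ|D_vQ
zero, on inertia θ₂^m = 1 and θ₁^m = ε^{(k−1)m}) ⟹ False. -/
@[route_item "route-Langlands-EvenSkinnerWilesMirror"]
def NoEvenReducibleOrdinary : Prop :=
  ∀ (p : ℕ) [Fact p.Prime], p ≠ 2 → ∀ (K : Type) [Field K] [NumberField K], NumberField.IsTotallyComplex K → Module.finrank ℚ K = 2 → (∀ w : IsDedekindDomain.HeightOneSpectrum (NumberField.RingOfIntegers K), (p : NumberField.RingOfIntegers K) ∈ w.asIdeal → w.residueCard = p ∧ ¬ w.asIdeal ^ 2 ∣ Ideal.span {(p : NumberField.RingOfIntegers K)}) → ∀ (O : ValuationSubring (PadicAlgCl p)), O = (Valued.v : Valuation (PadicAlgCl p) NNReal).valuationSubring → ∀ (ρ : Literature.NumberTheory.GaloisRepresentations.FramedGaloisRep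 ℚ (PadicAlgCl p) 2) (ρ₀ : Field.absoluteGaloisGroup ℚ →* Matrix.GeneralLinearGroup (Fin 2) O), ρ.toGaloisRep.IsIrreducible → ρ.IsEven → (∀ᶠ v in cofinite, ρ.IsUnramifiedAt v) → ρ.HasUpperTriangularIntegralModel ρ₀ → (∃ k : ℕ, 2 ≤ k ∧ Even k ∧ ∃ m : ℕ, 0 < m ∧ ∀ v : IsDedekindDomain.HeightOneSpectrum (NumberField.RingOfIntegers ℚ), (p : NumberField.RingOfIntegers ℚ) ∈ v.asIdeal → Literature.NumberTheory.GaloisRepresentations.IsPDistinguishedAt ρ₀ v ∧ ∃ Q : Matrix.GeneralLinearGroup (Fin 2) (PadicAlgCl p), Valued.v (Q.val 0 0) ≤ Valued.v (Q.val 1 0) ∧ ∀ σ, (Q⁻¹ * ρ.toLocal v σ * Q).val 1 0 = 0 ∧ (σ ∈ Literature.NumberTheory.GaloisRepresentations.absInertia (v.adicCompletion ℚ) → (Q⁻¹ * ρ.toLocal v σ * Q).val 1 1 ^ m = 1 ∧ (Q⁻¹ * ρ.toLocal v σ * Q).val 0 0 ^ m = algebraMap (Padic p) (PadicAlgCl p)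 (((Literature.NumberTheory.GaloisRepresentations.GaloisRep.cyclotomicCharacter (v.adicCompletion ℚ) p σ).val : PadicInt p) : Padic p) ^ ((k - 1) * m))) → False

/-- item stmt-Langlands-15309 · crux · rank 2 · open · by planner
why it might fail: FALSE without 'Even k' (Ind from a real quadratic field: even dihedral Maass λ=1/4, k=1); as typed the risk is normalisation (direction of the Satake–Frobenius ↔ central-character dictionary must give a+b ≡ k−1) and the archimedean clause of cyclic descent needed to read π₀'s infinity type.
sources: ArthurClozelAMS120, LanglandsBaseChange1980, Calegari2011, BuzzardGeeLMS2014, Deligne1971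
[crux] THE LEVER. p prime, K imaginary quadratic, ι : ℚ̄_p ≃ ℂ, ρ : Γ_ℚ → GL₂(ℚ̄_p) a.e. unramified
with ρ|_{Γ_K} irreducible and det(ρ)^N = ε^{(k−1)N} for some N ≥ 1 and some EVEN k ≥ 2 (det ρ is a
finite-order twist of an ODD power of the cyclotomic character); if ρ|_{Γ_K} is weakly
Bianchi-modular — some L-algebraic cuspidal π on GL₂(𝔸_K) has SatakeFrobCompatibleAt ι π (ρ|_K) w
for cofinitely many w — then ρ is ODD. Proof line: ρ|_K ≅ (ρ|_K)^c ⇒ π ≅ π^c (SMO) ⇒ π = BC(π₀)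
(Arthur–Clozel 4.2(d), with the archimedean clause) ⇒ ω_{π₀} = ψ‖·‖^{±(k−1)} (Satake–Frobenius at
split primes + rigidity of idele class characters of ℚ) ⇒ infinity type {(a,b),(b,a)} of π₀ has a +
b = ±(k−1) odd ⇒ a ≠ b ⇒ π₀ ⊗ |det|^{1/2} regular algebraic ⇒ ρ_{π₀} odd (Deligne) and ρ ≅ ρ_{π₀} ⊗
ε_K^j (Chebotarev + Brauer–Nesbitt over K, Clifford) ⇒ odd. [difficulty: L] -/
@[route_item "route-Langlands-EvenSkinnerWilesMirror", crux]
def BianchiMirrorParity : Prop :=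
  ∀ (p : ℕ) [Fact p.Prime] (K : Type) [Field K] [NumberField K], NumberField.IsTotallyComplex K → Module.finrank ℚ K = 2 → ∀ (hcpt : Literature.NumberTheory.Automorphic.isCompact_glFiniteIntegralLevel 2 K) (ι : PadicAlgCl p ≃+* ℂ) (ρ : Literature.NumberTheory.GaloisRepresentations.FramedGaloisRep ℚ (PadicAlgCl p) 2), (ρ.restrictField K).toGaloisRep.IsIrreducible → (∀ᶠ v in cofinite, ρ.IsUnramifiedAt v) → (∃ k N : ℕ, 2 ≤ k ∧ Even k ∧ 0 < N ∧ ∀ g : Field.absoluteGaloisGroup ℚ, ((Matrix.GeneralLinearGroup.det (ρ g) : (PadicAlgCl p)ˣ) : PadicAlgCl p) ^ N = algebraMap (Padic p) (PadicAlgCl p) (((Literature.NumberTheory.GaloisRepresentations.GaloisRep.cyclotomicCharacter ℚ p g).val : PadicInt p) : Padic p) ^ ((k - 1) * N)) → (∃ π : Literature.NumberTheory.Automorphic.CuspidalAutomorphicRepData 2 K hcpt, π.1.IsLAlgebraic ∧ ∀ᶠ w in cofinite, Summit.Langlands.SatakeFrobCompatibleAt ι π.1 (ρ.restrictField K) w)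 → ρ.IsOdd

/-- item stmt-Langlands-15310 · crux · rank 3 · closed · proved by Summit.Langlands.Langlands.Theorems.EvenSkinnerWilesMirrorMirrorEntry.mirrorEntry_proof (prover) · by planner
why it might fail: (ρ.restrictField K).toLocal w equals ρ.toLocal v only up to Γ_ℚ-conjugacy (absGaloisRestrict_isConj_of_algHom is a named fact); for inert p distinguishedness can die (χ̄_aχ̄_b⁻¹|D_p unramified quadratic) — hence p split; orientation transfer needs the conjugator integral and residually Borel.
sources: SkinnerWiles1999, MilneFT2022, Ribet1976, BellaicheChenevier2009
[crux] ENTERING THE MIRROR. Given the ℚ-side data of the target (p odd, O pinned, ρ irreducible,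
even, a.e. unramified, upper-triangular model ρ₀, even k ≥ 2, m, and at the place over p:
p-distinguished + oriented ordinary frame) and any imaginary quadratic K in which p splits (every w
∣ p of residue degree one, unramified), the restriction ρ|_{Γ_K} with ρ₀' := ρ₀ ∘ res satisfies
EVERY hypothesis of ReducibleOrdinaryModular over K: irreducible (an even irreducible ρ is never
induced from an imaginary quadratic field: Ind swaps the two lines, det ρ(c) = −1), a.e. unramified,
residually upper-triangular, and at each w ∣ p p-distinguished with an oriented ordinary frame (the
local groups at w and at p are identified up to Γ_ℚ-conjugacy; conjugating by ρ(τ) ∈ GL₂(O),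
upper-triangular mod 𝔪, preserves ‖Q₀₀‖ ≤ ‖Q₁₀‖ ultrametrically). [difficulty: M] -/
@[route_item "route-Langlands-EvenSkinnerWilesMirror", crux]
def MirrorEntry : Prop :=
  ∀ (p : ℕ) [Fact p.Prime], p ≠ 2 → ∀ (O : ValuationSubring (PadicAlgCl p)), O = (Valued.v : Valuation (PadicAlgCl p) NNReal).valuationSubring → ∀ (ρ : Literature.NumberTheory.GaloisRepresentations.FramedGaloisRep ℚ (PadicAlgCl p) 2) (ρ₀ : Field.absoluteGaloisGroup ℚ →* Matrix.GeneralLinearGroup (Fin 2) O), ρ.toGaloisRep.IsIrreducible → ρ.IsEven → (∀ᶠ v in cofinite, ρ.IsUnramifiedAt v) → ρ.HasUpperTriangularIntegralModel ρ₀ → (∃ k : ℕ, 2 ≤ k ∧ Even k ∧ ∃ m : ℕ, 0 < m ∧ ∀ v : IsDedekindDomain.HeightOneSpectrum (NumberField.RingOfIntegers ℚ), (p : NumberField.RingOfIntegers ℚ) ∈ v.asIdeal → Literature.NumberTheory.GaloisRepresentations.IsPDistinguishedAt ρ₀ v ∧ ∃ Q : Matrix.GeneralLinearGroup (Fin 2)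 (PadicAlgCl p), Valued.v (Q.val 0 0) ≤ Valued.v (Q.val 1 0) ∧ ∀ σ, (Q⁻¹ * ρ.toLocal v σ * Q).val 1 0 = 0 ∧ (σ ∈ Literature.NumberTheory.GaloisRepresentations.absInertia (v.adicCompletion ℚ) → (Q⁻¹ * ρ.toLocal v σ * Q).val 1 1 ^ m = 1 ∧ (Q⁻¹ * ρ.toLocal v σ * Q).val 0 0 ^ m = algebraMap (Padic p) (PadicAlgCl p) (((Literature.NumberTheory.GaloisRepresentations.GaloisRep.cyclotomicCharacter (v.adicCompletion ℚ) p σ).val : PadicInt p) : Padic p) ^ ((k - 1) * m))) → ∀ (K : Type) [Field K] [NumberField K], NumberField.IsTotallyComplex K → Module.finrank ℚ K = 2 → (∀ w : IsDedekindDomain.HeightOneSpectrum (NumberField.RingOfIntegers K), (p : NumberField.RingOfIntegers K) ∈ w.asIdeal → w.residueCard = p ∧ ¬ w.asIdeal ^ 2 ∣ Ideal.span {(p : NumberField.RingOfIntegers K)}) → ∃ ρ₀' : Field.absoluteGaloisGroup K →* Matrix.GeneralLinearGroup (Fin 2) O, (ρ.restrictField K).toGaloisRep.IsIrreducible ∧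 (∀ᶠ w in cofinite, (ρ.restrictField K).IsUnramifiedAt w) ∧ (ρ.restrictField K).HasUpperTriangularIntegralModel ρ₀' ∧ (∃ k : ℕ, 2 ≤ k ∧ ∃ m : ℕ, 0 < m ∧ ∀ w : IsDedekindDomain.HeightOneSpectrum (NumberField.RingOfIntegers K), (p : NumberField.RingOfIntegers K) ∈ w.asIdeal → Literature.NumberTheory.GaloisRepresentations.IsPDistinguishedAt ρ₀' w ∧ ∃ Q : Matrix.GeneralLinearGroup (Fin 2) (PadicAlgCl p), Valued.v (Q.val 0 0) ≤ Valued.v (Q.val 1 0) ∧ ∀ σ, (Q⁻¹ * (ρ.restrictField K).toLocal w σ * Q).val 1 0 = 0 ∧ (σ ∈ Literature.NumberTheory.GaloisRepresentations.absInertia (w.adicCompletion K) → (Q⁻¹ * (ρ.restrictField K).toLocal w σ * Q).val 1 1 ^ m = 1 ∧ (Q⁻¹ * (ρ.restrictField K).toLocal w σ * Q).val 0 0 ^ m = algebraMap (Padic p) (PadicAlgCl p) (((Literature.NumberTheory.GaloisRepresentations.GaloisRep.cyclotomicCharacter (w.adicCompletion K) p σ).val : PadicInt p) : Padic p) ^ ((k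 - 1) * m)))

-- `MirrorEntry` holds: proved by `Summit.Langlands.Langlands.Theorems.EvenSkinnerWilesMirrorMirrorEntry.mirrorEntry_proof` (its module imports this route file, so no `_holds` link can be stated here).

/-- item stmt-Langlands-12918 · crux · rank 4 · open · by planner
why it might fail: = Fontaine–Mazur (B) in SW's sector over imaginary quadratic F (defect one): reducible locus of dimension ≤ 3 only in the regime r₀ ≤ 2, auxiliary Steinberg re-entry and ordinary classicality over F unproved (judge key_risk of the parent route).
sources: SkinnerWiles1999, CalegariGeraghty2017, arXiv:2301.10509, BergerKlosin2009, AllenNewtonThorne2020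
[target] Thesis X above: Skinner–Wiles Theorem A over an imaginary quadratic F (IsTotallyComplex ∧
finrank ℚ F = 2), p ≠ 2, O pinned to the valuation ring of ℚ̄_p, ρ irreducible and a.e. unramified
with a residually upper-triangular integral model ρ₀ (`HasUpperTriangularIntegralModel`), one
parallel weight k ≥ 2 and exponent m ≥ 1 such that at every v ∣ p: `IsPDistinguishedAt ρ₀ v` and an
ORIENTED ordinary frame Q (‖Q₀₀‖ ≤ ‖Q₁₀‖; lower-left of Q⁻¹ρ|D_vQ vanishes; on inertia θ₂^m = 1,
θ₁^m = ε^{(k-1)m}, the clause of `isOrdinaryOfWeightAt_iff_padicAlgCl`) ⟹ ∃ L-algebraic cuspidal π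
with `SatakeFrobCompatibleAt ι π ρ v` for cofinitely many v. Sector of
`Summit.Langlands.GaloisToAutomorphic 2` (Satake form; ordinary ⇒ de Rham, no PstWeilDeligneData
touched). Non-vacuous: ρ = T₅(11a1)|Γ_F for F = ℚ(√-2) with the isogeny-adapted lattice meets every
hypothesis. -/
@[route_item "route-Langlands-EvenSkinnerWilesMirror", crux]
def ReducibleOrdinaryModular : Prop :=
  ∀ (F : Type) [Field F] [NumberField F], NumberField.IsTotallyComplex F → Module.finrank ℚ F = 2 → ∀ (p : ℕ) [Fact p.Prime], p ≠ 2 → ∀ (O : ValuationSubring (PadicAlgCl p)), O = (Valued.v : Valuation (PadicAlgCl p) NNReal).valuationSubring → ∀ (hcpt : Literature.NumberTheory.Automorphic.isCompact_glFiniteIntegralLevel 2 F) (ι : PadicAlgCl p ≃+* ℂ) (ρ : Literature.NumberTheory.GaloisRepresentations.FramedGaloisRep F (PadicAlgCl p) 2) (ρ₀ : Field.absoluteGaloisGroup F →* Matrix.GeneralLinearGroup (Fin 2) O), ρ.toGaloisRep.IsIrreducible → (∀ᶠ v in cofinite, ρ.IsUnramifiedAt v) → ρ.HasUpperTriangularIntegralModel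 ρ₀ → (∃ k : ℕ, 2 ≤ k ∧ ∃ m : ℕ, 0 < m ∧ ∀ v : IsDedekindDomain.HeightOneSpectrum (NumberField.RingOfIntegers F), (p : NumberField.RingOfIntegers F) ∈ v.asIdeal → Literature.NumberTheory.GaloisRepresentations.IsPDistinguishedAt ρ₀ v ∧ ∃ Q : Matrix.GeneralLinearGroup (Fin 2) (PadicAlgCl p), Valued.v (Q.val 0 0) ≤ Valued.v (Q.val 1 0) ∧ ∀ σ, (Q⁻¹ * ρ.toLocal v σ * Q).val 1 0 = 0 ∧ (σ ∈ Literature.NumberTheory.GaloisRepresentations.absInertia (v.adicCompletion F) → (Q⁻¹ * ρ.toLocal v σ * Q).val 1 1 ^ m = 1 ∧ (Q⁻¹ * ρ.toLocal v σ * Q).val 0 0 ^ m = algebraMap (Padic p) (PadicAlgCl p) (((Literature.NumberTheory.GaloisRepresentations.GaloisRep.cyclotomicCharacter (v.adicCompletion F) p σ).val : PadicInt p) : Padic p) ^ ((k - 1) * m))) → ∃ π : Literature.NumberTheory.Automorphic.CuspidalAutomorphicRepData 2 F hcpt, π.1.IsLAlgebraic ∧ ∀ᶠ v in cofinite, Summit.Langlands.SatakeFrobCompatibleAt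 ι π.1 ρ v

/-- item stmt-Langlands-15311 · crux · rank 8 · closed · proved by Summit.Langlands.Langlands.Theorems.EvenSkinnerWilesMirrorDeterminantParity.determinantParity_proof (prover) · by planner
why it might fail: only by a mismatch between the local cyclotomic character at v.adicCompletion ℚ and the global one on Γ_ℚ under toLocal (a tree-API compatibility not yet stated), or if the image of det ρ were not profinite — both are bookkeeping, not mathematics.
sources: NeukirchANT1999, CasselsFrohlichANT1967, SkinnerWiles1999
[crux] BOOKKEEPING (provable now, class field theory of ℚ): p odd, ρ : Γ_ℚ → GL₂(ℚ̄_p) a.e.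
unramified, k ≥ 2, m ≥ 1, and at the place over p an (un-oriented) ordinary frame with θ₂^m = 1,
θ₁^m = ε^{(k−1)m} on inertia ⟹ ∃ N ≥ 1 with det(ρ(g))^N = ε(g)^{(k−1)N} for all g ∈ Γ_ℚ. Proof: χ :=
det ρ · ε^{1−k} has χ^m trivial on I_p, finite order on every other inertia group (ℓ-adic inertia
into a p-adic field), so a power of χ is unramified at all finite places, hence trivial (ℚ has no
abelian extension unramified at all finite primes: Kronecker–Weber / Minkowski, Mathlib
NumberField.abs_discr_gt_two on finite quotients of the profinite image). [difficulty: provable-now] -/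
@[route_item "route-Langlands-EvenSkinnerWilesMirror", crux]
def DeterminantParity : Prop :=
  ∀ (p : ℕ) [Fact p.Prime], p ≠ 2 → ∀ (ρ : Literature.NumberTheory.GaloisRepresentations.FramedGaloisRep ℚ (PadicAlgCl p) 2), (∀ᶠ v in cofinite, ρ.IsUnramifiedAt v) → ∀ (k m : ℕ), 2 ≤ k → 0 < m → (∀ v : IsDedekindDomain.HeightOneSpectrum (NumberField.RingOfIntegers ℚ), (p : NumberField.RingOfIntegers ℚ) ∈ v.asIdeal → ∃ Q : Matrix.GeneralLinearGroup (Fin 2) (PadicAlgCl p), ∀ σ, (Q⁻¹ * ρ.toLocal v σ * Q).val 1 0 = 0 ∧ (σ ∈ Literature.NumberTheory.GaloisRepresentations.absInertia (v.adicCompletion ℚ) → (Q⁻¹ * ρ.toLocal v σ * Q).val 1 1 ^ m = 1 ∧ (Q⁻¹ * ρ.toLocal v σ * Q).val 0 0 ^ m = algebraMap (Padic p) (PadicAlgCl p) (((Literature.NumberTheory.GaloisRepresentations.GaloisRep.cyclotomicCharacter (v.adicCompletion ℚ) p σ).val : PadicInt p) : Padic p) ^ ((k - 1) * m))) → ∃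 N : ℕ, 0 < N ∧ ∀ g : Field.absoluteGaloisGroup ℚ, ((Matrix.GeneralLinearGroup.det (ρ g) : (PadicAlgCl p)ˣ) : PadicAlgCl p) ^ N = algebraMap (Padic p) (PadicAlgCl p) (((Literature.NumberTheory.GaloisRepresentations.GaloisRep.cyclotomicCharacter ℚ p g).val : PadicInt p) : Padic p) ^ ((k - 1) * N)

-- `DeterminantParity` holds: proved by `Summit.Langlands.Langlands.Theorems.EvenSkinnerWilesMirrorDeterminantParity.determinantParity_proof` (its module imports this route file, so no `_holds` link can be stated here).

/-- item stmt-Langlands-15312 · crux · rank 9 · open · by planner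
why it might fail: it IS global reciprocity for GL_n minus one vacuous sector; no engine is claimed; it closes only with the summit.
sources: BuzzardGeeLMS2014, FontaineMazurGeometric1995, Calegari2011
[crux] THE DECLARED RESIDUAL: the summit outside this (empty) sector — X → Langlands.
Summit-strength modulo X by design (every other (F, n, ρ, π), direction (A), and within n = 2 over ℚ
the odd, the residually irreducible even (Calegari), the non-ordinary and the odd-k even cases);
ranked last, not where this route directs provers, a crux so that the hypotheses of closes are
exactly the crux list (D-0027 §2.2). [deps: NoEvenReducibleOrdinary] [difficulty: open-problem] -/
@[route_item "route-Langlands-EvenSkinnerWilesMirror", crux]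
def SectorComplement : Prop :=
  NoEvenReducibleOrdinary → _root_.Langlands

/-- item stmt-Langlands-15313 · assembly · rank 1 · closed · proved by Summit.Langlands.Langlands.Theorems.evenSkinnerWilesMirror_assembly_proof (prover) · by planner
sources: SkinnerWiles1999, ArthurClozelAMS120, Calegari2011
[assembly] BianchiMirrorParity → MirrorEntry → ReducibleOrdinaryModular → DeterminantParity →
SectorComplement → Langlands (literally the type of closes; provable at once by `closes`). -/
@[route_item "route-Langlands-EvenSkinnerWilesMirror"]
def Assembly : Prop :=
  BianchiMirrorParity → MirrorEntry → ReducibleOrdinaryModular → DeterminantParity → SectorComplement → _root_.Langlands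

-- `Assembly` holds: proved by `Summit.Langlands.Langlands.Theorems.evenSkinnerWilesMirror_assembly_proof` (its module imports this route file, so no `_holds` link can be stated here).

/-! D-0027 §2.1 — DECIDING THEOREM (planner-authored via `route open/edit --closes-file`; by planner-plan-lens-Langlands-recomb-0 2026-08-16T15:21:48Z):
its hypotheses are this route's items and its conclusion the sub-problem Statement (glue_lint), and it elaborates with this file. -/

@[closes "route-Langlands-EvenSkinnerWilesMirror"] theorem closes (hP : BianchiMirrorParity) (hE : MirrorEntry) (hSW : ReducibleOrdinaryModular)
    (hD : DeterminantParity) (hC : SectorComplement) : _root_.Langlands := by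
  refine hC ?_
  intro p _ hp K _ _ hKc hK2 hsplit O hO ρ ρ₀ hirr heven hunr hut hloc
  obtain ⟨ι⟩ : Nonempty (PadicAlgCl p ≃+* ℂ) :=
    Literature.NumberTheory.GaloisRepresentations.NumberField.nonempty_algebraicClosure_padic_ringEquiv_complex p
  obtain ⟨ρ₀', hirrK, hunrK, hutK, hlocK⟩ :=
    hE p hp O hO ρ ρ₀ hirr heven hunr hut hloc K hKc hK2 hsplit
  obtain ⟨π, hπL, hπsat⟩ := hSW K hKc hK2 p hp O hO
    (Literature.NumberTheory.Automorphic.isCompact_glFiniteIntegralLevel_holds 2 K) ι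
    (ρ.restrictField K) ρ₀' hirrK hunrK hutK hlocK
  obtain ⟨k, hk2, hkev, m, hm, hv⟩ := hloc
  obtain ⟨N, hN, hdet⟩ := hD p hp ρ hunr k m hk2 hm (fun v hpv => by
    obtain ⟨_, Q, _, hQ⟩ := hv v hpv
    exact ⟨Q, hQ⟩)
  have hodd : ρ.IsOdd := hP p K hKc hK2
    (Literature.NumberTheory.Automorphic.isCompact_glFiniteIntegralLevel_holds 2 K) ι ρ hirrK hunr
    ⟨k, N, hk2, hkev, hN, hdet⟩ ⟨π, hπL, hπsat⟩
  exact heven.not_isOdd (Rat.castHom ℝ) two_ne_zero hodd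

end Summit.Langlands.Langlands.Theses.EvenSkinnerWilesMirror
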